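import Literature.Analysis.FluidPDE.PineauVicolRSS
import Literature.Analysis.FluidPDE.ParasiticSlabFlow
import Literature.Analysis.FluidPDE.TypeIAncientMild

/-!
# Crux `ForcedSymmetry` (stmt-NavierStokesRegularity-4052), negative side: the rotating parasitic
# soliton and the hypothesis (1.10) of Pineau–Vicol's RSS Liouville theorem

Drefute (gen 2) finding on stub 2b `stub_futureVertexLiouvilleRotated` of line `time-anchor-bootstrap`
(equivalently the RSS leaf of the sibling crux `SymmetricLiouville`, stmt-4053), as kernel-checked
NEGATIVE lemmas.  The only RSS Liouville fact in the tree is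
`Literature.Analysis.FluidPDE.pineauVicol2026_rss_liouville` (Pineau–Vicol 2026, Thm 1.4), whose
hypothesis is the SPACE–TIME Type-I bound (1.10) `‖u(t,x)‖ ≤ C₀/(‖x‖ + √(−t))`, while the class
`A_C = IsTypeIAncientMild C` of the crux carries only the TEMPORAL bound H4 `‖u(t,x)‖ ≤ C/√(−t)`.
This file shows that the gap is real at EVERY rotation rate `α`:

* `isClassicalNSSolutionOn_vecDrift` — every smooth spatially constant field `u(t,x) = c(t)` is a
  classical Navier–Stokes solution on `t < 0` with the linear pressure `p = −⟪c′(t), x⟫`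
  (KNSS 2009 §1, the parasitic solutions; vector-valued amplitude).
* `rotConst α t = (−t)^{-1/2} R(αs) e₀`, `s = −log(−t)` (`R = rotZ`), is EXACTLY the Pineau–Vicol
  RSS ansatz (1.7) with the constant profile `U ≡ e₀` (`rotConst_eq_pvAnsatz`, by `rfl`), is a
  classical solution on `[−1,0)` (`rotConst_isClassical_Ico`), obeys the temporal Type-I bound with
  `C = 1` (`rotConst_hasTypeITimeDecay`) but NO space–time bound (1.10) (`rotConst_not_hasTypeIDecay`),
  is not axisymmetric about the rotation axis (`rotConst_not_isAxisymmetric`), and its profile is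
  not zero.
* Hence `PVRSSLiouvilleTemporal` — `pineauVicol2026_rss_liouville` with (1.10) weakened to the
  temporal bound, everything else verbatim — is FALSE (`not_pvRSSLiouvilleTemporal`), and indeed
  fails at every `α` (`rotConst_counterexample`): no weakening of the tree's RSS fact can discharge
  stub 2b / the RSS leaf from H4 alone; the Oseen clause H3 must enter, and it does remove the
  witness (`rotConst_not_isTypeIAncientMild`, by `IsTypeIAncientMild.eq_zero_of_slice_const`).
  In profile terms: constants `U ≡ b₀` solve the RSS-Leray system (1.8) with the linear pressure
  `P = −(½ b₀ + αJb₀)·y` for every `α`, so the bounded-profile ("`L^∞` endpoint") RSS Liouville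
  that stub 2b encodes can at best conclude "`U` constant", exactly as Tsai's `q = ∞` theorem does
  at `α = 0`; the printed conjectures (Pineau–Vicol Conj. 1.1 = Tsai GSM 192 Conj. 8.9 =
  Bradshaw–Tsai OP 5.2) assume the profile decay (1.9) ⇔ (1.10) and say nothing about this class.

No statement of the route is asserted positively.

References: B. Pineau, V. Vicol, arXiv:2607.09619 (2026), (1.7), (1.9)–(1.10), Conj. 1.1, Rem. 1.2,
Thm 1.4 (pp. 3–4); G. Koch, N. Nadirashvili, G. Seregin, V. Šverák, Acta Math. 203 (2009), §1 p. 3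
(parasitic solutions `u = b(t)`, `p = −b′(t)·x`).
-/

noncomputable section

set_option linter.dupNamespace false

namespace Summit.NavierStokesRegularity.NavierStokesRegularity.Theorems.ForcedSymmetry.Negative.RotatingParasite

open MeasureTheory Set Function Filter Topology
open Literature.Analysis.FluidPDE
open scoped InnerProductSpace RealInnerProductSpace Laplacian ContDiff

/-- `ℝ³`. -/
abbrev E3 : Type := EuclideanSpace ℝ (Fin 3)

/-! ## Spatially constant fields are classical Navier–Stokes solutions (vector parasitic drifts) -/

/-- The spatially constant field `u(t, x) = c(t)`. -/
def vecDrift (c : ℝ → E3) : ℝ → E3 → E3 := fun t _ => c t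

/-- Its parasitic pressure `p(t, x) = −⟪c′(t), x⟫` (KNSS 2009 §1). -/
def vecDriftPressure (c : ℝ → E3) : ℝ → E3 → ℝ := fun t x => ⟪-deriv c t, x⟫

/-- **Parasitic solutions with vector amplitude.** For every `c ∈ C^∞((−∞,0); ℝ³)` the pair
`(c(t), −⟪c′(t), x⟫)` is a classical solution of Navier–Stokes (`ν = 1`, `f = 0`) on the open
backward slab: `∂ₜu = c′ = −∇p`, `(u·∇)u = 0`, `Δu = 0`, `div u = 0` (KNSS 2009, §1 p. 3). -/
theorem isClassicalNSSolutionOn_vecDrift {c : ℝ → E3} (hc : ContDiffOn ℝ ∞ c (Iio 0)) :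
    IsClassicalNSSolutionOn (Iio 0) 1 0 (vecDrift c) (vecDriftPressure c) where
  smooth_velocity := by
    have h : ContDiffOn ℝ ∞ (fun z : ℝ × E3 => c z.1) (Iio 0 ×ˢ univ) :=
      hc.comp contDiffOn_fst fun z hz => hz.1
    exact h
  smooth_pressure := by
    have hd : ContDiffOn ℝ ∞ (deriv c) (Iio 0) :=
      ((contDiffOn_infty_iff_deriv_of_isOpen isOpen_Iio).1 hc).2
    have h2 : ContDiffOn ℝ ∞ (fun z : ℝ × E3 => -deriv c z.1) (Iio 0 ×ˢ univ) :=
      (hd.comp contDiffOn_fst fun z hz => hz.1).neg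
    exact h2.inner ℝ contDiffOn_snd
  momentum := by
    intro t ht x
    have h1 : timeDerivWithin (Iio 0) (vecDrift c) t x = deriv c t := by
      rw [timeDerivWithin_apply, derivWithin_of_isOpen isOpen_Iio ht]
      rfl
    have h2 : convect (vecDrift c t) (vecDrift c t) x = 0 := by
      show fderiv ℝ (fun _ : E3 => c t) x (c t) = 0
      simp
    have h3 : Δ (vecDrift c t) x = 0 := by
      show Δ (fun _ : E3 => c t) x = 0
      rw [InnerProductSpace.laplacian_const]
      rfl
    have h4 : gradient (vecDriftPressure c t) x = -deriv c t := gradient_inner_left_eq _ x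
    rw [h1, h2, h3, h4]
    simp
  divFree := by
    intro t _ x
    show VectorCalculus.divergence (fun _ : E3 => c t) x = 0
    simp [VectorCalculus.divergence]

/-- Restriction to Pineau–Vicol's time set `[−1, 0)`. -/
theorem isClassicalNSSolutionOn_vecDrift_Ico {c : ℝ → E3} (hc : ContDiffOn ℝ ∞ c (Iio 0)) :
    IsClassicalNSSolutionOn (Ico (-1) 0) 1 0 (vecDrift c) (vecDriftPressure c) :=
  (isClassicalNSSolutionOn_vecDrift hc).mono Ico_subset_Iio_self (uniqueDiffOn_Ico _ _)

/-! ## The rotating parasitic soliton -/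

/-- The Pineau–Vicol rotation angle `α s`, `s = −log(−t)` (arXiv:2607.09619, (1.7)). -/
def rotAngle (α t : ℝ) : ℝ := α * -Real.log (-t)

/-- The rotating parasitic amplitude `c_α(t) = (−t)^{-1/2} R(αs) e₀`: the RSS ansatz (1.7) with the
constant profile `U ≡ e₀`. -/
def rotConst (α : ℝ) (t : ℝ) : E3 := (Real.sqrt (-t))⁻¹ • rotZ (rotAngle α t) parasiticDir

/-- `e₁ = (0, 1, 0)`. -/
def dir1 : E3 := EuclideanSpace.single 1 1

/-- `R(θ) e₀ = cos θ e₀ + sin θ e₁`. -/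
theorem rotZ_parasiticDir (θ : ℝ) :
    rotZ θ parasiticDir = Real.cos θ • parasiticDir + Real.sin θ • dir1 := by
  ext i
  fin_cases i <;> simp [parasiticDir, dir1, rotZ_apply_zero, rotZ_apply_one, rotZ_apply_two]

/-- The angle is smooth on `t < 0`. -/
theorem contDiffOn_rotAngle (α : ℝ) : ContDiffOn ℝ ∞ (rotAngle α) (Iio 0) := by
  have h1 : ContDiffOn ℝ ∞ (fun t : ℝ => -t) (Iio 0) := contDiffOn_id.neg
  have h2 : ContDiffOn ℝ ∞ (fun t : ℝ => Real.log (-t)) (Iio 0) :=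
    h1.log fun t ht => by simp only [mem_Iio] at ht; linarith
  exact contDiffOn_const.mul h2.neg

/-- `t ↦ (−t)^{-1/2}` is smooth on `t < 0`. -/
theorem contDiffOn_inv_sqrt_neg : ContDiffOn ℝ ∞ (fun t : ℝ => (Real.sqrt (-t))⁻¹) (Iio 0) := by
  have h := contDiffOn_parasiticAmp 1 (n := ∞)
  refine h.congr fun t _ => ?_
  simp [parasiticAmp, one_div]

/-- The rotating amplitude is smooth on `t < 0`. -/
theorem contDiffOn_rotConst (α : ℝ) : ContDiffOn ℝ ∞ (rotConst α) (Iio 0) := by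
  have hdir : ContDiffOn ℝ ∞ (fun t => rotZ (rotAngle α t) parasiticDir) (Iio 0) := by
    have e : (fun t => rotZ (rotAngle α t) parasiticDir) =
        fun t => Real.cos (rotAngle α t) • parasiticDir + Real.sin (rotAngle α t) • dir1 := by
      funext t; exact rotZ_parasiticDir _
    rw [e]
    exact ((Real.contDiff_cos.comp_contDiffOn (contDiffOn_rotAngle α)).smul contDiffOn_const).add
      ((Real.contDiff_sin.comp_contDiffOn (contDiffOn_rotAngle α)).smul contDiffOn_const)
  exact contDiffOn_inv_sqrt_neg.smul hdir

/-- `‖c_α(t)‖ = (−t)^{-1/2}` for `t < 0` (rotations are isometries, `‖e₀‖ = 1`). -/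
theorem norm_rotConst (α : ℝ) {t : ℝ} (ht : t < 0) : ‖rotConst α t‖ = (Real.sqrt (-t))⁻¹ := by
  have hs : 0 < Real.sqrt (-t) := Real.sqrt_pos.2 (by linarith)
  rw [rotConst, norm_smul, norm_inv, Real.norm_eq_abs, abs_of_pos hs, norm_rotZ, norm_parasiticDir,
    mul_one]

/-- **The rotating parasitic soliton IS the Pineau–Vicol RSS ansatz (1.7) with constant profile
`U ≡ e₀`**, at every rotation rate `α` (definitionally). -/
theorem rotConst_eq_pvAnsatz (α t : ℝ) (x : E3) :
    vecDrift (rotConst α) t x = pvAnsatz α (fun y _ => (fun _ : E3 => parasiticDir) y) t x := rfl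

/-- It is a classical Navier–Stokes solution on `[−1, 0)` with the parasitic pressure. -/
theorem rotConst_isClassical_Ico (α : ℝ) :
    IsClassicalNSSolutionOn (Ico (-1) 0) 1 0 (vecDrift (rotConst α)) (vecDriftPressure (rotConst α)) :=
  isClassicalNSSolutionOn_vecDrift_Ico (contDiffOn_rotConst α)

/-- It obeys the TEMPORAL Type-I bound H4 with `C = 1` (the class hypothesis of the crux). -/
theorem rotConst_hasTypeITimeDecay (α : ℝ) : HasTypeITimeDecay 1 (vecDrift (rotConst α)) := by
  intro t ht x
  show ‖rotConst α t‖ ≤ 1 / Real.sqrt (-t)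
  rw [norm_rotConst α ht, one_div]

/-- … but NO space–time Type-I bound (1.10), for any constant (test `x = R e₀` at `t = −1`). -/
theorem rotConst_not_hasTypeIDecay (α C' : ℝ) : ¬ HasTypeIDecay C' (vecDrift (rotConst α)) := by
  intro h
  set R : ℝ := |C'| + 1 with hR
  have hRpos : 0 < R := by positivity
  have key := h (-1) (by norm_num) (R • parasiticDir)
  have hn : ‖vecDrift (rotConst α) (-1) (R • parasiticDir)‖ = 1 := by
    show ‖rotConst α (-1)‖ = 1
    rw [norm_rotConst α (by norm_num)]
    simp
  rw [hn, norm_smul, norm_parasiticDir, mul_one, Real.norm_of_nonneg hRpos.le, neg_neg,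
    Real.sqrt_one, le_div_iff₀ (by positivity)] at key
  have : (1 : ℝ) * (R + 1) = |C'| + 2 := by rw [hR]; ring
  linarith [le_abs_self C']

/-- It is NOT axisymmetric about the rotation axis (its value at `t = −1` is the horizontal unit
vector `e₀`, moved by the rotation by `π`). -/
theorem rotConst_not_isAxisymmetric (α : ℝ) : ¬ IsAxisymmetric (vecDrift (rotConst α) (-1)) := by
  intro h
  have key := h Real.pi 0
  -- `vecDrift` is constant in space: `c = R_π c` with `c = rotConst α (-1) = e₀`
  have hc : rotConst α (-1) = parasiticDir := by
    simp [rotConst, rotAngle]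
  change rotConst α (-1) = rotZ Real.pi (rotConst α (-1)) at key
  rw [hc] at key
  have h0 := congrArg (fun v : E3 => v 0) key
  simp [parasiticDir, rotZ_apply_zero] at h0
  norm_num at h0

/-- The Oseen clause H3 removes it: the rotating parasitic soliton is in NO class `A_C`
(its slices are constant and it is not zero; `IsTypeIAncientMild.eq_zero_of_slice_const`). -/
theorem rotConst_not_isTypeIAncientMild (α C : ℝ) : ¬ IsTypeIAncientMild C (vecDrift (rotConst α)) := by
  intro h
  have key := h.eq_zero_of_slice_const (b := rotConst α) (fun t _ x => rfl) (t := -1) (by norm_num) 0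
  have hn := norm_rotConst α (show (-1 : ℝ) < 0 by norm_num)
  have : vecDrift (rotConst α) (-1) 0 = rotConst α (-1) := rfl
  rw [this] at key
  rw [key, norm_zero] at hn
  simp at hn

/-! ## Pineau–Vicol's Theorem 1.4 with (1.10) weakened to the temporal bound is false at every `α` -/

/-- `pineauVicol2026_rss_liouville` (Pineau–Vicol 2026 Thm 1.4, as typed in the tree) with its
space–time Type-I hypothesis (1.10) `‖u(t,x)‖ ≤ C₀/(‖x‖ + √(−t))` replaced by the TEMPORAL bound
`‖u(t,x)‖ ≤ C₀/√(−t)` (the H4 of the crux class); everything else verbatim. -/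
def PVRSSLiouvilleTemporal : Prop :=
  ∀ C₀ : ℝ, 0 < C₀ → ∃ α₁ α₂ : ℝ, 0 < α₁ ∧ 0 < α₂ ∧
    ∀ (α : ℝ) (u : ℝ → E3 → E3) (p : ℝ → E3 → ℝ) (U : E3 → E3),
      IsClassicalNSSolutionOn (Ico (-1) 0) 1 0 u p →
      (∀ t ∈ Ico (-1 : ℝ) 0, ∀ x : E3, ‖u t x‖ ≤ C₀ / Real.sqrt (-t)) →
      ContDiff ℝ 2 U →
      (∀ t ∈ Ico (-1 : ℝ) 0, ∀ x : E3, u t x = pvAnsatz α (fun y _ => U y) t x) →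
      (|α| < α₁ ∨ α₂ < |α|) → U = 0

/-- **The counterexample, uniformly in `α`.** The rotating parasitic soliton satisfies every
hypothesis of `PVRSSLiouvilleTemporal` with `C₀ = 1` and has the nonzero constant profile `e₀`. -/
theorem rotConst_counterexample (α : ℝ) :
    IsClassicalNSSolutionOn (Ico (-1) 0) 1 0 (vecDrift (rotConst α)) (vecDriftPressure (rotConst α)) ∧
    (∀ t ∈ Ico (-1 : ℝ) 0, ∀ x : E3, ‖vecDrift (rotConst α) t x‖ ≤ 1 / Real.sqrt (-t)) ∧
    ContDiff ℝ 2 (fun _ : E3 => parasiticDir) ∧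
    (∀ t ∈ Ico (-1 : ℝ) 0, ∀ x : E3,
      vecDrift (rotConst α) t x = pvAnsatz α (fun y _ => (fun _ : E3 => parasiticDir) y) t x) ∧
    (fun _ : E3 => parasiticDir) ≠ 0 := by
  refine ⟨rotConst_isClassical_Ico α, fun t ht x => rotConst_hasTypeITimeDecay α t ht.2 x,
    contDiff_const, fun t _ x => rotConst_eq_pvAnsatz α t x, fun h => ?_⟩
  have h0 := congrFun h 0
  have hn := norm_parasiticDir
  simp only [Pi.zero_apply] at h0
  rw [h0, norm_zero] at hn
  exact zero_ne_one hn

/-- **(1.10) cannot be weakened to H4 in the RSS Liouville theorem, at any rotation rate.** -/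
theorem not_pvRSSLiouvilleTemporal : ¬ PVRSSLiouvilleTemporal := by
  intro h
  obtain ⟨α₁, α₂, -, hα₂, H⟩ := h 1 one_pos
  obtain ⟨hsol, hbd, hU, hans, hne⟩ := rotConst_counterexample (α₂ + 1)
  refine hne (H (α₂ + 1) _ _ _ hsol hbd hU hans (Or.inr ?_))
  rw [abs_of_pos (by linarith)]
  linarith

end Summit.NavierStokesRegularity.NavierStokesRegularity.Theorems.ForcedSymmetry.Negative.RotatingParasite

end
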